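import Mathlib
import Summits.Ventures.HSemireg.LineLawPrincipalGenus
import Summits.Ventures.HSemireg.LineLawIdealProduct
import Summits.Ventures.HSemireg.LineLawPrincipalProper

/-!
# LINE LAW — THEOREM E «⇒» assembled: two weights on one reached line are ALIGNED (ENGINE-W code B, #B17)

THEOREM E of the LINE LAW (card LINE-LAW-B.md §22, consolidated text LINE-LAW-THEOREMS-B.md §6″) says, in its
necessity half: on a coordinate weight line reached at winding `T` with residue `A` — i.e. for every weight `c` a
divisor datum `z_c · w_c = A − √m` in `ℤ√m` with `N z_c = T / c` (THEOREM CF⁶, by value) — ALL the ideals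
`𝔞_c(A) = (c, −A + √m)` lie in one ideal class.  In the tree so far: the pair case for `s` prime to the weights
(`LineLawPairLaw.pairLaw_aligned_of_reached`, coprime product formula) and the two halves of the general argument as
separate leaves — the one-sided bookkeeping `𝔞_{n₁}(A)·𝔞_{n₂}(A) = 𝔞_{n₁n₂}(A)` under `gcd(n₁, n₂, 2A) = 1`
(`LineLawIdealProduct`, #B14) and its gcd hypothesis on a reached line (`LineLawProperness` #B15 given primitivity,
`LineLawPrincipalProper` #B16 for every datum).  This file COMPOSES them with the §11 PROPOSITION
(`LineLawPrincipalGenus.span_eq_of_dvd_of_norm`: `(N z, −A + √m) = (z)` for a divisor `z` of `A − √m`):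
* `principal_mul_weightIdeal` — for every datum, `(z_c) · 𝔞_c(A) = 𝔞_T(A)`;
* `aligned_of_reached` — for ANY two weights `c₁, c₂` of a line reached at `(T, A)` with `T ∣ A² − m`:
  `(z_{c₁}) · 𝔞_{c₁}(A) = (z_{c₂}) · 𝔞_{c₂}(A)`, a Cox-(7.8) relation, so `[𝔞_{c₁}(A)] = [𝔞_{c₂}(A)]` — no
  coprimality between the weights or with the cofactor, no squarefree or sign hypothesis on `m`;
* `classLaw_necessity` — with LEMMA P (i) of #B16 (`winding_dvd_of_bezout`: `T ∣ A² − m` as soon as the weights have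
  no common divisor): THEOREM E «⇒» for an arbitrary finite family of weights with `gcd = 1`, every `𝔞_{cᵢ}(A)` being
  moreover a PROPER ideal by #B16's `weightForm_primitive_of_bezout` (so «one class» lives in the form class group).
Honest framing: ideal arithmetic in `ℤ√m` only; THEOREM CF⁶ (which words reach which lines) enters by value; Mukai
vectors and lattices elsewhere, not objects; nothing here says that HC, HC_CM or HC_AV holds.
-/

namespace Summit.Ventures.HSemireg.LineLawClassLawNecessity

open Zsqrtd
open Summit.Ventures.HSemireg.LineLawPrincipalGenus (span_eq_of_dvd_of_norm)
open HSemireg.LineLawIdealProduct (primIdeal_mul_of_gcd)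
open Summit.Ventures.HSemireg.LineLawPrincipalProper (gcd_hypothesis_of_datum norm_mul_weight_dvd
  winding_dvd_of_bezout winding_dvd_of_coprime_pair)

/-- **`(z_c) · 𝔞_c(A) = 𝔞_T(A)`** for every divisor datum `z · w = A − √m` with `T = c · N z ≠ 0` and `T ∣ A² − m`:
the §11 PROPOSITION gives `(z) = (N z, −A + √m)`, #B16 gives `gcd(N z, c, 2A) = 1`, and #B14's bookkeeping gives
`(N z, −A + √m)(c, −A + √m) = (N z · c, −A + √m) = (T, −A + √m)`. -/
theorem principal_mul_weightIdeal {m A T c : ℤ} {z w : ℤ√m} (h : z * w = ⟨A, -1⟩) (hT : T = c * z.norm)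
    (hdiv : T ∣ A * A - m) (hT0 : T ≠ 0) :
    Ideal.span {z} * Ideal.span {(c : ℤ√m), ⟨-A, 1⟩} = Ideal.span {(T : ℤ√m), ⟨-A, 1⟩} := by
  have hn : z.norm ≠ 0 := by
    intro h0; apply hT0; rw [hT, h0, mul_zero]
  -- `A² − N z · N w = m`
  have hc' : A ^ 2 - z.norm * w.norm = m := by
    have e : (z * w).norm = A * A - m * (-1) * (-1) := by rw [h, Zsqrtd.norm_def]
    rw [Zsqrtd.norm_mul] at e
    linear_combination (-1 : ℤ) * e
  have e1 : Ideal.span {((z.norm : ℤ) : ℤ√m), ⟨-A, 1⟩} = Ideal.span {z} :=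
    span_eq_of_dvd_of_norm hc' ⟨w, h.symm⟩ (Or.inl rfl)
  have e2 : Ideal.span {((z.norm : ℤ) : ℤ√m), ⟨-A, 1⟩} * Ideal.span {(c : ℤ√m), ⟨-A, 1⟩} =
      Ideal.span {((z.norm * c : ℤ) : ℤ√m), ⟨-A, 1⟩} :=
    primIdeal_mul_of_gcd (norm_mul_weight_dvd hT hdiv) (gcd_hypothesis_of_datum h hT hdiv hn)
  have e3 : (z.norm * c : ℤ) = T := by rw [hT, mul_comm]
  rw [← e1, e2, e3]

/-- **THEOREM E «⇒» for two weights (alignment).** If the weights `c₁, c₂` both lie on a line reached at `(T, A)`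
— data `zᵢ · wᵢ = A − √m`, `T = cᵢ · N zᵢ` — and `T ∣ A² − m` (LEMMA P (i); automatic when the line's weights are
coprime as a set, `winding_dvd_of_bezout`), then `(z₁) · 𝔞_{c₁}(A) = (z₂) · 𝔞_{c₂}(A)`: the compatible ideals
`𝔞_{c₁}(A)`, `𝔞_{c₂}(A)` satisfy a Cox-(7.8) relation, i.e. have the same class.  No coprimality hypothesis. -/
theorem aligned_of_reached {m A T c₁ c₂ : ℤ} {z₁ w₁ z₂ w₂ : ℤ√m}
    (h₁ : z₁ * w₁ = ⟨A, -1⟩) (h₂ : z₂ * w₂ = ⟨A, -1⟩) (hT₁ : T = c₁ * z₁.norm) (hT₂ : T = c₂ * z₂.norm)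
    (hdiv : T ∣ A * A - m) (hT0 : T ≠ 0) :
    Ideal.span {z₁} * Ideal.span {(c₁ : ℤ√m), ⟨-A, 1⟩} = Ideal.span {z₂} * Ideal.span {(c₂ : ℤ√m), ⟨-A, 1⟩} := by
  rw [principal_mul_weightIdeal h₁ hT₁ hdiv hT0, principal_mul_weightIdeal h₂ hT₂ hdiv hT0]

/-- **THEOREM E «⇒» (kernel, assembled).** Let a finite family of weights `c i`, `i ∈ s`, with no common divisor
(`∑ a i · c i = 1`) lie on ONE line reached at `(T, A)`, `T ≠ 0`: data `z i · w i = A − √m`, `T = c i · N (z i)`.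
Then for all `i, j ∈ s`: `(z i) · 𝔞_{c i}(A) = (z j) · 𝔞_{c j}(A)` — the compatible family `(𝔞_{c i}(A))` lies in
one ideal class of `ℤ√m`.  (THEOREM CF⁶, i.e. which transport words produce such data, is by value; the converse
«⇐» needs an auxiliary ideal in a prescribed class — Cox Cor. 7.17 — and is by value, pairs∕triples in
`LineLawPairLaw`.) -/
theorem classLaw_necessity {m A T : ℤ} {ι : Type*} (s : Finset ι) (c a : ι → ℤ) (z w : ι → ℤ√m)
    (h : ∀ i ∈ s, z i * w i = ⟨A, -1⟩) (hT : ∀ i ∈ s, T = c i * (z i).norm)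
    (hbez : ∑ i ∈ s, a i * c i = 1) (hT0 : T ≠ 0) {i j : ι} (hi : i ∈ s) (hj : j ∈ s) :
    Ideal.span {z i} * Ideal.span {(c i : ℤ√m), ⟨-A, 1⟩} = Ideal.span {z j} * Ideal.span {(c j : ℤ√m), ⟨-A, 1⟩} :=
  aligned_of_reached (h i hi) (h j hj) (hT i hi) (hT j hj) (winding_dvd_of_bezout s c a z w h hT hbez) hT0

/-- The two-weight case with coprime weights spelled out (`u c₁ + v c₂ = 1`): no divisibility hypothesis left. -/
theorem aligned_of_reached_coprime {m A T c₁ c₂ u v : ℤ} {z₁ w₁ z₂ w₂ : ℤ√m}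
    (h₁ : z₁ * w₁ = ⟨A, -1⟩) (h₂ : z₂ * w₂ = ⟨A, -1⟩) (hT₁ : T = c₁ * z₁.norm) (hT₂ : T = c₂ * z₂.norm)
    (hbez : u * c₁ + v * c₂ = 1) (hT0 : T ≠ 0) :
    Ideal.span {z₁} * Ideal.span {(c₁ : ℤ√m), ⟨-A, 1⟩} = Ideal.span {z₂} * Ideal.span {(c₂ : ℤ√m), ⟨-A, 1⟩} :=
  aligned_of_reached h₁ h₂ hT₁ hT₂ (winding_dvd_of_coprime_pair h₁ h₂ hT₁ hT₂ hbez) hT0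

/-- Worked check of the hypotheses' shape (LINE-LAW-THEOREMS-B.md §9 (1): `m = −5`, line `{1, 5, 6}` at `T = 30`,
`A = 5`): the data `z₃₀ = 5 − l`, `z₆ = 1 + l`, `z₅ = l` with cofactors `1`, `−l`, `−1 − l`. -/
example : (⟨5, -1⟩ : ℤ√(-5)) * 1 = ⟨5, -1⟩ ∧ (⟨1, 1⟩ : ℤ√(-5)) * ⟨0, -1⟩ = ⟨5, -1⟩ ∧
    (⟨0, 1⟩ : ℤ√(-5)) * ⟨-1, -1⟩ = ⟨5, -1⟩ ∧ (30 : ℤ) = 1 * (⟨5, -1⟩ : ℤ√(-5)).norm ∧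
    (30 : ℤ) = 5 * (⟨1, 1⟩ : ℤ√(-5)).norm ∧ (30 : ℤ) = 6 * (⟨0, 1⟩ : ℤ√(-5)).norm := by
  refine ⟨by ext <;> simp, by ext <;> simp, by ext <;> simp, ?_, ?_, ?_⟩ <;> simp [Zsqrtd.norm_def]

end Summit.Ventures.HSemireg.LineLawClassLawNecessity
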